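import Summits.BirchSwinnertonDyer.BirchSwinnertonDyer.Theorems.SylvesterTwoHeegnerIndexCoupledTelescopeLevelInvariance
import Summits.BirchSwinnertonDyer.BirchSwinnertonDyer.Theorems.SylvesterTwoHeegnerIndexCoupledTelescopeGalTower
import Literature.NumberTheory.EllipticCurves.GeomPointsEmbeddingDescent
import HarnessLib

/-!
# The COUPLED Cassels–Tate telescope, XXXV: the recipe's invariance input (R5) `hP` for the derived point
# `D_n y_n` at a general square-free conductor — (T10)+(T13)+(T14) composed with the tree's finite-level descent
# (RESIDUE c v3 (T-L1), class term)

Crux `UpperOffV0HSYPlus` (stmt-BirchSwinnertonDyer-19804).  k-ty1 SPEC §5 (R5): the recipe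
`HuShuYin2019.exists_cmFrame_kolyvaginClass` needs `hP : ∀ h ∈ N', ∃ a ∈ E(K̄)^N, 2^M • a = h • P − P` for the
derived point `P`.  For `P = ιe(D_l y)` at an embedded level `L = K[N]`, `N = 9p·n₀` (`N` the fixer of `emb L`,
`N'` the fixer of `emb K[9p]`), this file composes: the tree's `exists_fixedPoints_zsmul_eq_of_finite_level`
(`GeomPointsEmbeddingDescent`: it suffices to treat `σ ∈ Aut(L/K)` fixing `K[9p]`), (T13)
`ringClassGalOver_le_iSup_primeFactors` (`Gal(L/K[9p]) ≤ ⨆_q G_q`), the generator data `⟨σ_q⟩ = G_q` ((T15) for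
the coherent choice), and (T14) `exists_zsmul_eq_pointGalHom_foldr_derivOp_sub` (Gross 3.6 for `j = 0`).
* ★ `exists_fixedPoints_zsmul_eq_foldr_derivOp` — (R5) for `ιe (D_l y)` in `W₀(K̄)`, from the list data
  `(σ_q, q)_{q ∣ n₀}` (pairwise commuting, `⟨σ_q⟩ = G_q`, `σ_q^{q+1} = 1`, `2^M ∣ q+1`, `Σ_{i≤q} σ_q^i y = 0`).
Theorems only (no definition / named fact / instance / notation); nothing asserted on 19804; no stub closed;
X12.CMAtTwo NOT proved; BSD not claimed for any curve.  Sources: [GrossLMS1991] §3 Prop. 3.6, §4 (4.1)–(4.2);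
[McCallumLMS1991] §4 (4); [HuShuYin2019] §4.1.  `lean search 'exists_fixedPoints_zsmul_eq_foldr'` → nothing before this file.
-/

set_option linter.dupNamespace false -- Summits modules are `Summit.<Summit>.<Problem>…` by design
set_option autoImplicit false

noncomputable section

open scoped Classical

namespace Summit.BirchSwinnertonDyer.BirchSwinnertonDyer.Theorems.SylvesterTwoCMFlip

open WeierstrassCurve Field NumberField Finset
open Literature.NumberTheory.EllipticCurves
  Summit.BirchSwinnertonDyer.Rank1Residual.X11b.RingClassTower
  Summit.BirchSwinnertonDyer.Rank1Residual.X11b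

variable {K : Type} [Field K] [NumberField K]

set_option maxHeartbeats 800000 in
/-- ★ **(R5) for the derived point at a general square-free conductor.**  `K` imaginary quadratic, a base
`d ≠ 0` (HSY: `d = 9p`) and a square-free `n₀` prime to `d`, `N = d·n₀`; an embedded `L = K[N]` (`emb`, `ιe`,
fixer `N`, the `K[d]`-fixer `N'`); a list `l` of `(σ_q, q)` covering the primes of `n₀` with `⟨σ_q⟩ = G_q =
Gal(L/K[N/q])`, pairwise commuting, `σ_q^{q+1} = 1`, `2^M ∣ q + 1`, and a point `y ∈ W(L)` with all traces
`Σ_{i ≤ q} σ_q^i y = 0`.  Then every `h ∈ N'` moves `ιe(D_l y)` by `2^M · W(K̄)^N`.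
[cite: GrossLMS1991, Prop. 3.6, §4 (4.1)–(4.2)] [cite: McCallumLMS1991, §4 (4)] -/
theorem exists_fixedPoints_zsmul_eq_foldr_derivOp (hK : IsImaginaryQuadratic K) (ι : K →+* ℂ)
    (W : WeierstrassCurve ℚ) {d n₀ N : ℕ} (hd : d ≠ 0) (hsq : Squarefree n₀) (hcop : Nat.Coprime n₀ d)
    (hN : d * n₀ = N)
    (emb : ringClassField K ι N →+* AlgebraicClosure K)
    (hemb : ∀ k : K, emb (algebraMap K (ringClassField K ι N) k) = algebraMap K (AlgebraicClosure K) k)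
    (ιe : letI : DecidableEq (ringClassField K ι N) := fun a b ↦ Classical.propDecidable (a = b)
      (W.baseChange (ringClassField K ι N)).toAffine.Point →+ geomPoints (W.baseChange K))
    (hιe : ∀ P, ιe P = Affine.Point.map (W' := W) emb.toRatAlgHom P)
    (Nfix : Subgroup (absoluteGaloisGroup K))
    (hNfix : ∀ g : absoluteGaloisGroup K, g ∈ Nfix ↔
      ∀ x : ringClassField K ι N, (show AlgebraicClosure K ≃ₐ[K] AlgebraicClosure K from g) (emb x) = emb x)
    (N' : Subgroup (absoluteGaloisGroup K))
    (hN' : ∀ g : absoluteGaloisGroup K, g ∈ N' ↔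
      ∀ x ∈ {x : ringClassField K ι N | (x : ℂ) ∈ ringClassField K ι d}, (show AlgebraicClosure K ≃ₐ[K] AlgebraicClosure K from g) (emb x) = emb x)
    (l : List ((ringClassField K ι N ≃ₐ[ℚ] ringClassField K ι N) × ℕ))
    (hcover : ∀ q ∈ n₀.primeFactors, ∃ a ∈ l, a.2 = q)
    (hgen : ∀ a ∈ l, Subgroup.zpowers a.1 = ringClassGalOver ι N (N / a.2))
    (hc : ∀ a ∈ l, ∀ b ∈ l, Commute a.1 b.1) (hord : ∀ a ∈ l, a.1 ^ (a.2 + 1) = 1) {M : ℕ}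
    (hdvd : ∀ a ∈ l, 2 ^ M ∣ a.2 + 1)
    {y : letI : DecidableEq (ringClassField K ι N) := fun a b ↦ Classical.propDecidable (a = b)
      (W.baseChange (ringClassField K ι N)).toAffine.Point}
    (htr : letI : DecidableEq (ringClassField K ι N) := fun a b ↦ Classical.propDecidable (a = b)
      ∀ a ∈ l, ∑ i ∈ Finset.range (a.2 + 1), pointGalHom W (ringClassField K ι N) (a.1 ^ i) y = 0)
    {h : absoluteGaloisGroup K} (hh : h ∈ N') :
    letI : DecidableEq (ringClassField K ι N) := fun a b ↦ Classical.propDecidable (a = b)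
    ∃ a ∈ FixedPoints.addSubgroup Nfix (geomPoints (W.baseChange K)),
      ((2 ^ M : ℕ) : ℤ) • a =
        h • ιe (l.foldr (fun b z ↦ KolyvaginOperator.derivOp (pointGalHom W (ringClassField K ι N)) b.1 b.2 z) y) -
          ιe (l.foldr (fun b z ↦ KolyvaginOperator.derivOp (pointGalHom W (ringClassField K ι N)) b.1 b.2 z) y) := by
  letI : DecidableEq (ringClassField K ι N) := fun a b ↦ Classical.propDecidable (a = b)
  have hN0 : N ≠ 0 := by rw [← hN]; exact mul_ne_zero hd hsq.ne_zero
  haveI := (finiteDimensional_and_isGalois_ringClassField hK ι hN0).1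
  haveI := (finiteDimensional_and_isGalois_ringClassField hK ι hN0).2
  refine exists_fixedPoints_zsmul_eq_of_finite_level W emb hemb ιe hιe Nfix hNfix _ (((2 ^ M : ℕ) : ℤ))
    {x : ringClassField K ι N | (x : ℂ) ∈ ringClassField K ι d} (fun σ hσ ↦ ?_) h ((hN' h).mp hh)
  -- `σ` (over `K`, fixing `K[d]`) lies in `Gal(L/K[d]) ≤ ⨆ G_q ≤ closure {σ_q}`
  have hmem : σ.restrictScalars ℚ ∈ ringClassGalOver ι N d :=
    (mem_fixingSubgroup_iff _).mpr fun x hx ↦ hσ x hx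
  have hsup := ringClassGalOver_le_iSup_primeFactors hK ι hsq hd hcop hN hmem
  have hcl : (⨆ q ∈ n₀.primeFactors, ringClassGalOver ι N (N / q)) ≤
      Subgroup.closure {g | ∃ a ∈ l, a.1 = g} := by
    refine iSup₂_le fun q hq ↦ ?_
    obtain ⟨a, ha, rfl⟩ := hcover q hq
    rw [← hgen a ha]
    exact (Subgroup.zpowers_le).mpr (Subgroup.subset_closure ⟨a, ha, rfl⟩)
  obtain ⟨z, hz⟩ := exists_zsmul_eq_pointGalHom_foldr_derivOp_sub W l hc hord hdvd htr (hcl (hsup))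
  have e : ∀ P : (W.baseChange (ringClassField K ι N)).toAffine.Point,
      pointGalHom W (ringClassField K ι N) (σ.restrictScalars ℚ) P =
        Affine.Point.map (W' := W) ((σ : ringClassField K ι N →+* ringClassField K ι N)).toRatAlgHom P := by
    intro P
    rw [pointGalHom_apply]
    rcases P with _ | ⟨x₁, y₁, hP⟩
    · rfl
    · exact Affine.Point.some_eq_some_of_eq rfl rfl
  refine ⟨z, ?_⟩
  rw [hz, e]

end Summit.BirchSwinnertonDyer.BirchSwinnertonDyer.Theorems.SylvesterTwoCMFlip

end
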